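import Mathlib
import HarnessLib
import Summits.Ventures.LatticeQCDFlow.Exactness.SphereFlowTransportSource
import Summits.Ventures.LatticeQCDFlow.Exactness.SphereLuscherTrivialization

/-!
# The Jacobian of the trivializing flow on the lattice of site spheres, by Liouville's formula along the trajectory: `J_{s→c}(x) = exp(−∫_s^c Σ_n∂̃_n·∂̃_nG_u(Φ_{s→u}x)du)` and the change of variables `∫ J_{s→c}(ω)·H(Φ_{s→c}ω) dπ̄(ω) = ∫ H dπ̄` for every jointly `C³` generator and every `C¹` observable

HONEST FRAMING: exact (Metropolis-corrected) sampling algorithms for lattice gauge theory;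
figures of merit are autocorrelation/cost numbers at stated couplings and volumes; no
continuum-physics claim.

Venture `LatticeQCDFlow` (cell pub-lqcd), topic `Exactness`; FANOUT row 7 (`s0-cpn-null`: the
S0-D1 rung — 2D CP⁹, Lüscher's LO trivializing map inside HMC, Engel–Schaefer 2011).  NEW WORK of
the cell over the tree's `Exactness/SphereFlowTransportSource.lean` (this leg: the transport
identity with a source term, parametric smoothness of the site Laplacian, `C¹` parametric
primitives), `Exactness/SphereTimeDependentFlow.lean` (GEN-14: the time-dependent flow
`Φ_{t₀→t} = sphereTDFlow`, Chapman–Kolmogorov, conserved site norms, the pull-back derivative) and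
`Exactness/SphereLuscherTrivialization.lean` (GEN-14: the effective generator `ψ_T(s)·G_s` on
`Ω`); nothing is cited as a fact.  Printed counterpart, NAMED ONLY: M. Lüscher, "Trivializing
maps, the Wilson flow and the HMC algorithm", Commun. Math. Phys. 293 (2010) 899, §3.2 eqs.
(3.6)–(3.9): along the flow `U̇_t = Z_t(U_t)` generated by `Z_t = −∂S̃_t` the Jacobian obeys
`(d/dt) ln det Φ_t^* = −Σ(∂∂S̃_t)∘Φ_t` (Liouville's formula), so that the pulled-back action of the
trivialized theory is `S(Φ_t) − ln det Φ_t^*`; Engel–Schaefer 2011 §3 eq. (18) (the HMC in the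
trivialized variables uses exactly this action).  GEN-14 obtained the trivialization theorem
WITHOUT the Jacobian (by transporting the observable) and listed "the Jacobian / Liouville formula
of `Φ`" and "the residual action" as NOT CLAIMED.  THIS FILE supplies the Jacobian, in the weak form
that characterises it:

* §1 **THE LOG-JACOBIAN FAMILY** `ℓ_{s→c}(x) = sphereTDFlowLogJac hG T s c x`
  `= −∫_s^c χ(Φ_{s→u}x)·Σ_n∂̃_n·∂̃_nG_u(Φ_{s→u}x) du` (def; the configuration cut-off `χ` is `1`
  along every trajectory started on `Ω̃`, **`sphereTDFlowLogJac_eq_of_norm_eq_one`**): `ℓ_{c→c} = 0`,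
  and `(s, x) ↦ ℓ_{s→c}(x)` is jointly `C¹` on `ℝ × (Λ → E)` for a jointly `C³` generator
  (**`contDiff_sphereTDFlowLogJac`**, a `C¹` parametric primitive of the cut-off Laplacian along the
  jointly `C¹` flow);
* §2 **THE CHARACTERISTIC IDENTITY** (**`hasDerivAt_sphereTDFlowLogJac_initial`**): on `Ω̃`, for
  every real `s`, `(d/ds) ℓ_{s→c}(x) = Σ_n∂̃_n·∂̃_nG_s(x) + D(ℓ_{s→c})(x)·(ψ_T(s)∂̃G_s(x))` — along the
  flow line through `x` the log-Jacobian decreases at the rate of the site Laplacian (differentiate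
  `σ ↦ ℓ_{σ→c}(Φ_{s→σ}x) = −∫_σ^c …` once by the fundamental theorem of calculus and once by the
  chain rule);
* §3 **LIOUVILLE'S THEOREM / THE CHANGE OF VARIABLES FOR THE FLOW MAP**
  (**`integral_exp_sphereTDFlowLogJac_mul_comp_sphereTDFlow`**): for `|s|, |c| ≤ |T| + 1` (the
  window where the flow is Lüscher's `ẋ = −∂̃G_t(x)`) and every `C¹` observable `H`,
  `∫ e^{ℓ_{s→c}(ω)}·H(Φ_{s→c}ω) dπ̄(ω) = ∫ H dπ̄`:
  the evolution map `Φ_{s→c}` pushes the measure `e^{ℓ_{s→c}}π̄` forward to `π̄`, i.e. `e^{ℓ_{s→c}}`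
  IS the Jacobian of `Φ_{s→c}` with respect to the product measure (the function `J` with
  `∫ J·(H∘Φ) dπ̄ = ∫ H dπ̄` for all `H`).  Proof: the family `K_σ = e^{ℓ_{σ→c}}·(H∘Φ_{σ→c})` satisfies
  `∂_σK_σ = DK_σ·∂̃G_σ + (Σ∂̃²G_σ)K_σ` on `Ω` (§2 and the pull-back derivative), so by the transport
  identity with source `(d/dσ)∫K_σ dπ̄ = ∫K_σ(−Σ∂̃²G_σ + Σ∂̃²G_σ)dπ̄ = 0` in the window, and
  `K_c = H`; also stated with the cut-off removed
  (**`integral_exp_neg_intervalIntegral_mul_comp_sphereTDFlow`**).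

The sequel `Exactness/SphereFlowResidualAction.lean` turns this into the exact reweighting / residual
action of flow-HMC, `∫ e^{ℓ_{0→c} − cS∘Φ_{0→c}}·(H∘Φ_{0→c}) dπ̄ = ∫ e^{−cS}H dπ̄`, with
`cS∘Φ_{0→c} − ℓ_{0→c} = ∫_0^c (S − 𝓛_uG_u)∘Φ_{0→u} du` the integrated residual of Lüscher's equation.

NOT CLAIMED: that `e^{ℓ}` is the determinant of `DΦ_{s→c}` in charts of the manifold `Ω` (no
Riemannian Jacobian is defined — the change-of-variables identity is what is proved and used);
generators only jointly `C²`; bounded-measurable / total-variation test functions (the weak form uses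
`C¹` ambient functionals); anything quantitative, acceptance rates, autocorrelations, the rung's numbers.
-/

noncomputable section

namespace Summit.Ventures.LatticeQCDFlow.Exactness

open Function Set Metric MeasureTheory NormedSpace InnerProductSpace
open scoped RealInnerProductSpace Topology

variable {Λ : Type*} {E : Type*} [NormedAddCommGroup E] [InnerProductSpace ℝ E]
  [FiniteDimensional ℝ E] [Fintype Λ] [DecidableEq Λ]

/-! ## §1 The log-Jacobian family -/

section LogJac

variable {G : ℝ → (Λ → E) → ℝ} {T : ℝ}

/-- **The log-Jacobian of the evolution map `Φ_{s→c}` at `x`** (Liouville's formula along the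
trajectory through `x`): `ℓ_{s→c}(x) = −∫_s^c χ(Φ_{s→u}x)·Σ_n ∂̃_n·∂̃_nG_u(Φ_{s→u}x) du`, where
`Φ = sphereTDFlow hG T` and `χ` is the configuration cut-off (`= 1` on `Ω̃`, where the formula reads
`−∫_s^c Σ_n ∂̃_n·∂̃_nG_u(Φ_{s→u}x) du`; the cut-off only makes `ℓ` globally `C¹`). -/
def sphereTDFlowLogJac (hG : ContDiff ℝ 2 fun q : ℝ × (Λ → E) => G q.1 q.2) (T s c : ℝ)
    (x : Λ → E) : ℝ :=
  -∫ u in s..c, sphereCutoff (sphereTDFlow hG T s u x) *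
      ∑ n, siteLaplacian n (G u) (sphereTDFlow hG T s u x)

/-- `ℓ_{c→c} = 0`. -/
@[simp]
theorem sphereTDFlowLogJac_self (hG : ContDiff ℝ 2 fun q : ℝ × (Λ → E) => G q.1 q.2) (c : ℝ)
    (x : Λ → E) : sphereTDFlowLogJac hG T c c x = 0 := by
  simp [sphereTDFlowLogJac, intervalIntegral.integral_same]

/-- **On `Ω̃` the cut-off disappears**: `ℓ_{s→c}(x) = −∫_s^c Σ_n ∂̃_n·∂̃_nG_u(Φ_{s→u}x) du` for
`x ∈ Ω̃` (every site norm is conserved along the flow). -/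
theorem sphereTDFlowLogJac_eq_of_norm_eq_one (hG : ContDiff ℝ 2 fun q : ℝ × (Λ → E) => G q.1 q.2)
    (s c : ℝ) {x : Λ → E} (hx : ∀ n, ‖x n‖ = 1) :
    sphereTDFlowLogJac hG T s c x =
      -∫ u in s..c, ∑ n, siteLaplacian n (G u) (sphereTDFlow hG T s u x) := by
  unfold sphereTDFlowLogJac
  congr 1
  refine intervalIntegral.integral_congr fun u _ => ?_
  simp only [sphereCutoff_eq_one (norm_sphereTDFlow_eq_one hG s hx u), one_mul]

/-- The cut-off Laplacian evaluated along the flow, `(u, (s, x)) ↦ χ(Φ_{s→u}x)·Σ_n∂̃²_nG_u(Φ_{s→u}x)`,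
is `C¹` on `ℝ × (ℝ × (Λ → E))` for a jointly `C³` generator. -/
theorem contDiff_sphereCutoff_mul_sum_siteLaplacian_comp_sphereTDFlow
    (hG : ContDiff ℝ 2 fun q : ℝ × (Λ → E) => G q.1 q.2)
    (hG3 : ContDiff ℝ 3 fun q : ℝ × (Λ → E) => G q.1 q.2) :
    ContDiff ℝ 1 fun r : ℝ × (ℝ × (Λ → E)) =>
      sphereCutoff (sphereTDFlow hG T r.2.1 r.1 r.2.2) *
        ∑ n, siteLaplacian n (G r.1) (sphereTDFlow hG T r.2.1 r.1 r.2.2) := by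
  have hΦ : ContDiff ℝ 1 fun r : ℝ × (ℝ × (Λ → E)) => sphereTDFlow hG T r.2.1 r.1 r.2.2 :=
    (contDiff_sphereTDFlow hG).comp
      ((contDiff_fst.comp contDiff_snd).prodMk (contDiff_fst.prodMk (contDiff_snd.comp contDiff_snd)))
  exact (contDiff_sphereCutoff_mul_sum_siteLaplacian hG3).comp (contDiff_fst.prodMk hΦ)

/-- **The log-Jacobian is jointly `C¹` in `(s, x)`** on `ℝ × (Λ → E)` (jointly `C³` generator): a
difference of two `C¹` parametric primitives of the cut-off Laplacian along the jointly `C¹` flow. -/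
theorem contDiff_sphereTDFlowLogJac (hG : ContDiff ℝ 2 fun q : ℝ × (Λ → E) => G q.1 q.2)
    (hG3 : ContDiff ℝ 3 fun q : ℝ × (Λ → E) => G q.1 q.2) (c : ℝ) :
    ContDiff ℝ 1 fun q : ℝ × (Λ → E) => sphereTDFlowLogJac hG T q.1 c q.2 := by
  set F : ℝ × (ℝ × (Λ → E)) → ℝ := fun r =>
    sphereCutoff (sphereTDFlow hG T r.2.1 r.1 r.2.2) *
      ∑ n, siteLaplacian n (G r.1) (sphereTDFlow hG T r.2.1 r.1 r.2.2) with hF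
  have hFd : ContDiff ℝ 1 F := contDiff_sphereCutoff_mul_sum_siteLaplacian_comp_sphereTDFlow hG hG3
  have hP : ContDiff ℝ 1 fun z : ℝ × (ℝ × (Λ → E)) => ∫ u in (0 : ℝ)..z.1, F (u, z.2) :=
    contDiff_one_parametric_primitive hFd
  have hint : ∀ (q : ℝ × (Λ → E)) (a b : ℝ), IntervalIntegrable (fun u => F (u, q)) volume a b :=
    fun q a b => (hFd.continuous.comp (continuous_id.prodMk continuous_const)).intervalIntegrable a b
  have heq : (fun q : ℝ × (Λ → E) => sphereTDFlowLogJac hG T q.1 c q.2) = fun q =>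
      (∫ u in (0 : ℝ)..q.1, F (u, q)) - ∫ u in (0 : ℝ)..c, F (u, q) := by
    funext q
    rw [sphereTDFlowLogJac, ← intervalIntegral.integral_interval_sub_left (hint q 0 c) (hint q 0 q.1),
      neg_sub]
  rw [heq]
  exact (hP.comp (contDiff_fst.prodMk contDiff_id)).sub (hP.comp (contDiff_const.prodMk contDiff_id))

/-- Each `x ↦ ℓ_{s→c}(x)` is `C¹`. -/
theorem contDiff_sphereTDFlowLogJac_apply (hG : ContDiff ℝ 2 fun q : ℝ × (Λ → E) => G q.1 q.2)
    (hG3 : ContDiff ℝ 3 fun q : ℝ × (Λ → E) => G q.1 q.2) (s c : ℝ) :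
    ContDiff ℝ 1 fun x : Λ → E => sphereTDFlowLogJac hG T s c x := by
  have h2 : ContDiff ℝ 1 fun x : Λ → E => ((s, x) : ℝ × (Λ → E)) :=
    (contDiff_const (c := s)).prodMk contDiff_id
  have h3 := (contDiff_sphereTDFlowLogJac hG hG3 c (T := T)).comp h2
  exact h3

/-- The transported, Jacobian-weighted observable `K_σ(z) = e^{ℓ_{σ→c}(z)}·H(Φ_{σ→c}z)` is jointly
`C¹` in `(σ, z)` (`H ∈ C¹`). -/
theorem contDiff_exp_sphereTDFlowLogJac_mul_comp
    (hG : ContDiff ℝ 2 fun q : ℝ × (Λ → E) => G q.1 q.2)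
    (hG3 : ContDiff ℝ 3 fun q : ℝ × (Λ → E) => G q.1 q.2) {H : (Λ → E) → ℝ} (hH : ContDiff ℝ 1 H)
    (c : ℝ) :
    ContDiff ℝ 1 fun p : ℝ × (Λ → E) =>
      Real.exp (sphereTDFlowLogJac hG T p.1 c p.2) * H (sphereTDFlow hG T p.1 c p.2) :=
  (contDiff_sphereTDFlowLogJac hG hG3 c).exp.mul (hH.comp (contDiff_sphereTDFlow_initial hG c))

end LogJac

/-! ## §2 The characteristic identity -/

section Characteristic

variable {G : ℝ → (Λ → E) → ℝ} {T : ℝ}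

/-- Along the flow line the log-Jacobian is an integral with moving lower limit only:
`ℓ_{σ→c}(Φ_{s→σ}x) = −∫_σ^c χ(Φ_{s→u}x)·Σ_n∂̃²_nG_u(Φ_{s→u}x) du` (Chapman–Kolmogorov). -/
theorem sphereTDFlowLogJac_sphereTDFlow (hG : ContDiff ℝ 2 fun q : ℝ × (Λ → E) => G q.1 q.2)
    (s σ c : ℝ) (x : Λ → E) :
    sphereTDFlowLogJac hG T σ c (sphereTDFlow hG T s σ x) =
      -∫ u in σ..c, sphereCutoff (sphereTDFlow hG T s u x) *
        ∑ n, siteLaplacian n (G u) (sphereTDFlow hG T s u x) := by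
  simp only [sphereTDFlowLogJac, sphereTDFlow_trans]

/-- **THE CHARACTERISTIC IDENTITY.**  For a jointly `C³` generator, `x ∈ Ω̃` and all real `c`, `s`:
`(d/ds) ℓ_{s→c}(x) = Σ_n∂̃_n·∂̃_nG_s(x) + D(ℓ_{s→c})(x)·(ψ_T(s)∂̃G_s(x))`
(the log-Jacobian solves the transport equation `∂_sℓ + Dℓ·X_T(s, ·) = Σ∂̃²G_s` along the
cut-off field `X_T(s, x) = −ψ_T(s)∂̃G_s(x)`: differentiate `σ ↦ ℓ_{σ→c}(Φ_{s→σ}x)` at `σ = s` by the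
fundamental theorem of calculus and by the chain rule, and compare). -/
theorem hasDerivAt_sphereTDFlowLogJac_initial (hG : ContDiff ℝ 2 fun q : ℝ × (Λ → E) => G q.1 q.2)
    (hG3 : ContDiff ℝ 3 fun q : ℝ × (Λ → E) => G q.1 q.2) {x : Λ → E} (hx : ∀ n, ‖x n‖ = 1)
    (c s : ℝ) :
    HasDerivAt (fun s' => sphereTDFlowLogJac hG T s' c x)
      (∑ n, siteLaplacian n (G s) x +
        fderiv ℝ (fun z => sphereTDFlowLogJac hG T s c z) x
          (fun n => (timeBump T : ℝ → ℝ) s • siteGrad n (G s) x)) s := by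
  -- `Ψ(σ, z) = ℓ_{σ→c}(z)` is jointly `C¹`; `L` is its derivative at `(s, x)`
  have hΨd : ContDiff ℝ 1 (fun q : ℝ × (Λ → E) => sphereTDFlowLogJac hG T q.1 c q.2) :=
    contDiff_sphereTDFlowLogJac hG hG3 c
  obtain ⟨L, hL⟩ : ∃ L : ℝ × (Λ → E) →L[ℝ] ℝ,
      HasFDerivAt (fun q : ℝ × (Λ → E) => sphereTDFlowLogJac hG T q.1 c q.2) L (s, x) :=
    ⟨_, (hΨd.differentiable one_ne_zero (s, x)).hasFDerivAt⟩
  -- the flow line through `x` at time `s`, with velocity `X_T(s, x)` at `σ = s`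
  have hγ : HasDerivAt (fun σ => sphereTDFlow hG T s σ x) (sphereTDField G T (s, x)) s := by
    have h := hasDerivAt_sphereTDFlow_field hG s x s (T := T)
    simp only [sphereTDFlow_self] at h
    exact h
  -- (a) chain rule along the flow line: derivative `L (1, X_T(s, x))`
  have ha : HasDerivAt
      ((fun q : ℝ × (Λ → E) => sphereTDFlowLogJac hG T q.1 c q.2) ∘
        fun σ : ℝ => (σ, sphereTDFlow hG T s σ x))
      (L ((1 : ℝ), sphereTDField G T (s, x))) s :=
    hL.comp_hasDerivAt_of_eq s ((hasDerivAt_id' s).prodMk hγ) (by simp)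
  -- (b) fundamental theorem of calculus along the flow line: derivative `χ(x)Σ∂̃²G_s(x)`
  have hfc : Continuous fun u : ℝ => sphereCutoff (sphereTDFlow hG T s u x) *
      ∑ n, siteLaplacian n (G u) (sphereTDFlow hG T s u x) := by
    have hF := (contDiff_sphereCutoff_mul_sum_siteLaplacian_comp_sphereTDFlow hG hG3 (T := T)).continuous
    have hj : Continuous fun u : ℝ => ((u, (s, x)) : ℝ × (ℝ × (Λ → E))) :=
      continuous_id.prodMk continuous_const
    have h := hF.comp hj
    exact h
  have hb : HasDerivAt
      ((fun q : ℝ × (Λ → E) => sphereTDFlowLogJac hG T q.1 c q.2) ∘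
        fun σ : ℝ => (σ, sphereTDFlow hG T s σ x))
      (sphereCutoff (sphereTDFlow hG T s s x) *
        ∑ n, siteLaplacian n (G s) (sphereTDFlow hG T s s x)) s := by
    have e : ((fun q : ℝ × (Λ → E) => sphereTDFlowLogJac hG T q.1 c q.2) ∘
        fun σ : ℝ => (σ, sphereTDFlow hG T s σ x)) =
        fun σ => -∫ u in σ..c, sphereCutoff (sphereTDFlow hG T s u x) *
          ∑ n, siteLaplacian n (G u) (sphereTDFlow hG T s u x) := by
      funext σ
      simp only [comp_apply, sphereTDFlowLogJac_sphereTDFlow]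
    rw [e]
    have h := (intervalIntegral.integral_hasDerivAt_left (hfc.intervalIntegrable _ _)
      hfc.aestronglyMeasurable.stronglyMeasurableAtFilter hfc.continuousAt (b := c) (a := s)).neg
    exact h.congr_deriv (neg_neg _)
  have hab : L ((1 : ℝ), sphereTDField G T (s, x)) = ∑ n, siteLaplacian n (G s) x := by
    have h := ha.unique hb
    simp only [sphereTDFlow_self, sphereCutoff_eq_one hx, one_mul] at h
    exact h
  -- (c) the `s`-slice: derivative `L (1, 0) = L (1, X) − L (0, X)`
  have hc : HasDerivAt
      ((fun q : ℝ × (Λ → E) => sphereTDFlowLogJac hG T q.1 c q.2) ∘ fun σ : ℝ => (σ, x))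
      (L ((1 : ℝ), (0 : Λ → E))) s :=
    hL.comp_hasDerivAt_of_eq s ((hasDerivAt_id' s).prodMk (hasDerivAt_const s x)) rfl
  have hslice : ∀ v : Λ → E,
      L ((0 : ℝ), v) = fderiv ℝ (fun z => sphereTDFlowLogJac hG T s c z) x v := by
    intro v
    have h2 : HasFDerivAt
        ((fun q : ℝ × (Λ → E) => sphereTDFlowLogJac hG T q.1 c q.2) ∘ fun z : Λ → E => (s, z))
        (L.comp (ContinuousLinearMap.inr ℝ ℝ (Λ → E))) x :=
      hL.comp x (hasFDerivAt_prodMk_right s x)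
    rw [show (fun z => sphereTDFlowLogJac hG T s c z) =
        (fun q : ℝ × (Λ → E) => sphereTDFlowLogJac hG T q.1 c q.2) ∘ fun z : Λ → E => (s, z)
        from rfl, h2.fderiv]
    rfl
  have hsplit : L ((1 : ℝ), (0 : Λ → E)) =
      L ((1 : ℝ), sphereTDField G T (s, x)) - L ((0 : ℝ), sphereTDField G T (s, x)) := by
    rw [← map_sub, Prod.mk_sub_mk, sub_zero, sub_self]
  have hX : sphereTDField G T (s, x) = -fun n => (timeBump T : ℝ → ℝ) s • siteGrad n (G s) x := by
    rw [sphereTDField_eq_of_norm_eq_one s hx]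
    funext n
    simp
  rw [hsplit, hab, hslice, hX, map_neg, sub_neg_eq_add] at hc
  exact hc

end Characteristic

/-! ## §3 Liouville's theorem: the change of variables for the flow map -/

section Liouville

variable {G : ℝ → (Λ → E) → ℝ} {T : ℝ}

/-- **THE TRANSPORT PROPERTY OF THE JACOBIAN-WEIGHTED OBSERVABLE.**  On `Ω` and for every real
`σ`: `(d/dσ) K_σ(ω) = DK_σ(ω)·∂̃(ψ_T(σ)G_σ)(ω) + (Σ_n∂̃_n·∂̃_nG_σ(ω))·K_σ(ω)` for
`K_σ = e^{ℓ_{σ→c}}·(H∘Φ_{σ→c})` (the characteristic identity, the pull-back derivative and the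
product rule). -/
theorem hasDerivAt_exp_sphereTDFlowLogJac_mul_comp
    (hG : ContDiff ℝ 2 fun q : ℝ × (Λ → E) => G q.1 q.2)
    (hG3 : ContDiff ℝ 3 fun q : ℝ × (Λ → E) => G q.1 q.2) {H : (Λ → E) → ℝ} (hH : ContDiff ℝ 1 H)
    (c σ : ℝ) (ω : Λ → sphere (0 : E) 1) :
    HasDerivAt (fun σ' => Real.exp (sphereTDFlowLogJac hG T σ' c (fun m => (ω m : E))) *
        H (sphereTDFlow hG T σ' c (fun m => (ω m : E))))
      (fderiv ℝ (fun z => Real.exp (sphereTDFlowLogJac hG T σ c z) * H (sphereTDFlow hG T σ c z))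
          (fun m => (ω m : E))
          (fun n => siteGrad n (fun z : Λ → E => (timeBump T : ℝ → ℝ) σ * G σ z) (fun m => (ω m : E))) +
        (∑ n, siteLaplacian n (G σ) (fun m => (ω m : E))) *
          (Real.exp (sphereTDFlowLogJac hG T σ c (fun m => (ω m : E))) *
            H (sphereTDFlow hG T σ c (fun m => (ω m : E))))) σ := by
  have hω : ∀ n, ‖(fun m => ((ω m : sphere (0 : E) 1) : E)) n‖ = 1 := norm_sphereConfig_eq_one ω
  -- the three one-variable derivatives
  have hB := hasDerivAt_sphereTDFlowLogJac_initial hG hG3 hω c σ (T := T)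
  have hE := hB.exp
  have hP := hasDerivAt_comp_sphereTDFlow_initial hG (hH.differentiable one_ne_zero) hω c σ (T := T)
  have hprod := hE.fun_mul hP
  -- the Fréchet derivative of `K_σ` at `ω`
  have hℓ : HasFDerivAt (fun z => sphereTDFlowLogJac hG T σ c z)
      (fderiv ℝ (fun z => sphereTDFlowLogJac hG T σ c z) (fun m => (ω m : E))) (fun m => (ω m : E)) :=
    (((contDiff_sphereTDFlowLogJac_apply hG hG3 σ c).differentiable one_ne_zero) _).hasFDerivAt
  have hHΦ : HasFDerivAt (fun z => H (sphereTDFlow hG T σ c z))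
      (fderiv ℝ (fun z => H (sphereTDFlow hG T σ c z)) (fun m => (ω m : E))) (fun m => (ω m : E)) :=
    (((hH.comp (contDiff_sphereTDFlow_apply hG σ c)).differentiable one_ne_zero) _).hasFDerivAt
  have hK := hℓ.exp.fun_mul hHΦ
  have hVW : (fun n => siteGrad n (fun z : Λ → E => (timeBump T : ℝ → ℝ) σ * G σ z) (fun m => (ω m : E))) =
      fun n => (timeBump T : ℝ → ℝ) σ • siteGrad n (G σ) (fun m => (ω m : E)) := by
    funext n; exact siteGrad_timeBump_mul hG σ ω n
  refine hprod.congr_deriv ?_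
  rw [hK.fderiv, hVW]
  simp only [_root_.add_apply, _root_.smul_apply, smul_eq_mul]
  ring

variable [MeasurableSpace E] [BorelSpace E] [Nontrivial E]

/-- **THE JACOBIAN-WEIGHTED TRANSPORTED MEAN IS STATIONARY IN THE WINDOW.**  For `|σ| ≤ |T| + 1`,
`(d/dσ) ∫ e^{ℓ_{σ→c}(ω)}·H(Φ_{σ→c}ω) dπ̄(ω) = 0`. -/
theorem hasDerivAt_integral_exp_sphereTDFlowLogJac_mul_comp
    (hG : ContDiff ℝ 2 fun q : ℝ × (Λ → E) => G q.1 q.2)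
    (hG3 : ContDiff ℝ 3 fun q : ℝ × (Λ → E) => G q.1 q.2) {H : (Λ → E) → ℝ} (hH : ContDiff ℝ 1 H)
    (c : ℝ) {σ : ℝ} (hσ : |σ| ≤ |T| + 1) :
    HasDerivAt (fun σ' => ∫ ω, Real.exp (sphereTDFlowLogJac hG T σ' c
        (fun m => ((ω : Λ → sphere (0 : E) 1) m : E))) * H (sphereTDFlow hG T σ' c (fun m => (ω m : E)))
          ∂Measure.pi (fun _ : Λ => uniformSphere (volume : Measure E))) 0 σ := by
  have h := hasDerivAt_integral_family_source
    (K := fun σ' z => Real.exp (sphereTDFlowLogJac hG T σ' c z) * H (sphereTDFlow hG T σ' c z))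
    (q := fun σ' z => ∑ n, siteLaplacian n (G σ') z)
    (Gs := fun σ' z => (timeBump T : ℝ → ℝ) σ' * G σ' z)
    (contDiff_exp_sphereTDFlowLogJac_mul_comp hG hG3 hH c) (contDiff_timeBump_mul hG)
    (continuous_siteGrad_timeBump_mul hG)
    (continuous_finsetSum _ fun n _ => continuous_siteLaplacian_param_sphereConfig hG3 n)
    (fun σ' ω => hasDerivAt_exp_sphereTDFlowLogJac_mul_comp hG hG3 hH c σ' ω) σ
  refine h.congr_deriv ?_
  refine (integral_congr_ae (ae_of_all _ fun ω => ?_)).trans (integral_zero _ _)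
  have hlap : ∑ n, siteLaplacian n (fun z : Λ → E => (timeBump T : ℝ → ℝ) σ * G σ z)
      (fun m => ((ω : Λ → sphere (0 : E) 1) m : E)) =
      ∑ n, siteLaplacian n (G σ) (fun m => (ω m : E)) := by
    rw [sum_siteLaplacian_const_mul_sphereConfig (contDiff_of_joint hG σ) _ ω, timeBump_eq_one hσ,
      one_mul]
  simp only [hlap, neg_add_cancel, mul_zero]

/-- **LIOUVILLE'S THEOREM FOR THE TRIVIALIZING FLOW / THE CHANGE OF VARIABLES FOR `Φ_{s→c}`.**
Let `G : ℝ → (Λ → E) → ℝ` be jointly `C³`, `Φ = sphereTDFlow hG T` the evolution maps of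
`ẋ_n = −∂̃_nG_t(x)` (exact for `|t| ≤ |T| + 1`), `|s|, |c| ≤ |T| + 1`, and `H ∈ C¹`.  Then
`∫ e^{ℓ_{s→c}(ω)}·H(Φ_{s→c}ω) dπ̄(ω) = ∫ H dπ̄`,
`ℓ_{s→c}(ω) = −∫_s^c Σ_n∂̃_n·∂̃_nG_u(Φ_{s→u}ω) du`: the density `e^{ℓ_{s→c}}` is the Jacobian of the
evolution map with respect to the product measure — Liouville's formula `(d/dt) ln J = (div X_t)∘Φ`
with `div(−∂̃G_t) = −Σ∂̃²G_t`, in the weak form that characterises `J`. -/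
theorem integral_exp_sphereTDFlowLogJac_mul_comp_sphereTDFlow
    (hG : ContDiff ℝ 2 fun q : ℝ × (Λ → E) => G q.1 q.2)
    (hG3 : ContDiff ℝ 3 fun q : ℝ × (Λ → E) => G q.1 q.2) {H : (Λ → E) → ℝ} (hH : ContDiff ℝ 1 H)
    {s c : ℝ} (hs : |s| ≤ |T| + 1) (hc : |c| ≤ |T| + 1) :
    ∫ ω, Real.exp (sphereTDFlowLogJac hG T s c (fun m => ((ω : Λ → sphere (0 : E) 1) m : E))) *
        H (sphereTDFlow hG T s c (fun m => (ω m : E)))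
          ∂Measure.pi (fun _ : Λ => uniformSphere (volume : Measure E)) =
      ∫ ω, H (fun m => ((ω : Λ → sphere (0 : E) 1) m : E))
        ∂Measure.pi (fun _ : Λ => uniformSphere (volume : Measure E)) := by
  set g : ℝ → ℝ := fun σ' => ∫ ω, Real.exp (sphereTDFlowLogJac hG T σ' c
      (fun m => ((ω : Λ → sphere (0 : E) 1) m : E))) * H (sphereTDFlow hG T σ' c (fun m => (ω m : E)))
        ∂Measure.pi (fun _ : Λ => uniformSphere (volume : Measure E)) with hg
  -- `g` is differentiable everywhere (transport identity with source), with derivative `0` in the window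
  have hdiff : ∀ σ', DifferentiableAt ℝ g σ' := fun σ' =>
    (hasDerivAt_integral_family_source
      (K := fun σ' z => Real.exp (sphereTDFlowLogJac hG T σ' c z) * H (sphereTDFlow hG T σ' c z))
      (q := fun σ' z => ∑ n, siteLaplacian n (G σ') z)
      (Gs := fun σ' z => (timeBump T : ℝ → ℝ) σ' * G σ' z)
      (contDiff_exp_sphereTDFlowLogJac_mul_comp hG hG3 hH c) (contDiff_timeBump_mul hG)
      (continuous_siteGrad_timeBump_mul hG)
      (continuous_finsetSum _ fun n _ => continuous_siteLaplacian_param_sphereConfig hG3 n)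
      (fun σ' ω => hasDerivAt_exp_sphereTDFlowLogJac_mul_comp hG hG3 hH c σ' ω) σ').differentiableAt
  have hzero : ∀ σ', |σ'| ≤ |T| + 1 → HasDerivAt g 0 σ' := fun σ' hσ' =>
    hasDerivAt_integral_exp_sphereTDFlowLogJac_mul_comp hG hG3 hH c hσ'
  -- hence `g` is constant on the interval between `s` and `c`
  have hwin : ∀ σ' ∈ Icc (min s c) (max s c), |σ'| ≤ |T| + 1 := by
    intro σ' hσ'
    rw [abs_le] at hs hc ⊢
    constructor
    · exact le_trans (le_min hs.1 hc.1) hσ'.1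
    · exact le_trans hσ'.2 (max_le hs.2 hc.2)
  have hconst := constant_of_has_deriv_right_zero (f := g) (a := min s c) (b := max s c)
    (fun σ' _ => (hdiff σ').continuousAt.continuousWithinAt)
    (fun σ' hσ' => ((hzero σ' (hwin σ' (Ico_subset_Icc_self hσ'))).hasDerivWithinAt))
  have hs' : g s = g (min s c) := hconst s ⟨min_le_left _ _, le_max_left _ _⟩
  have hc' : g c = g (min s c) := hconst c ⟨min_le_right _ _, le_max_right _ _⟩
  have hgc : g c = ∫ ω, H (fun m => ((ω : Λ → sphere (0 : E) 1) m : E))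
      ∂Measure.pi (fun _ : Λ => uniformSphere (volume : Measure E)) := by
    simp only [hg, sphereTDFlowLogJac_self, Real.exp_zero, one_mul, sphereTDFlow_self]
  rw [← hgc, hc', ← hs']

/-- **Liouville's theorem with the cut-off removed**: for `|s|, |c| ≤ |T| + 1` and `H ∈ C¹`,
`∫ exp(−∫_s^c Σ_n∂̃_n·∂̃_nG_u(Φ_{s→u}ω) du)·H(Φ_{s→c}ω) dπ̄(ω) = ∫ H dπ̄`. -/
theorem integral_exp_neg_intervalIntegral_mul_comp_sphereTDFlow
    (hG : ContDiff ℝ 2 fun q : ℝ × (Λ → E) => G q.1 q.2)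
    (hG3 : ContDiff ℝ 3 fun q : ℝ × (Λ → E) => G q.1 q.2) {H : (Λ → E) → ℝ} (hH : ContDiff ℝ 1 H)
    {s c : ℝ} (hs : |s| ≤ |T| + 1) (hc : |c| ≤ |T| + 1) :
    ∫ ω, Real.exp (-∫ u in s..c, ∑ n, siteLaplacian n (G u)
        (sphereTDFlow hG T s u (fun m => ((ω : Λ → sphere (0 : E) 1) m : E)))) *
        H (sphereTDFlow hG T s c (fun m => (ω m : E)))
          ∂Measure.pi (fun _ : Λ => uniformSphere (volume : Measure E)) =
      ∫ ω, H (fun m => ((ω : Λ → sphere (0 : E) 1) m : E))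
        ∂Measure.pi (fun _ : Λ => uniformSphere (volume : Measure E)) := by
  rw [← integral_exp_sphereTDFlowLogJac_mul_comp_sphereTDFlow hG hG3 hH hs hc]
  refine integral_congr_ae (ae_of_all _ fun ω => ?_)
  simp only [sphereTDFlowLogJac_eq_of_norm_eq_one hG s c (norm_sphereConfig_eq_one ω)]

end Liouville

end Summit.Ventures.LatticeQCDFlow.Exactness

end
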